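import Summits.QuantumAdvantage.QuantumAdvantage.Theorems.CubicForrelationNearExactIsExactEightFlatSums

/-!
# Crux `CubicForrelation.NearExactIsExact` (stmt-QuantumAdvantage-14043) — Reed–Muller distance on ABSTRACT FLATS

Certificate seat `b2b-cforr-cert` (generation 2), rung `θ₈ = 13/16`.  HONEST FRAMING: an elementary coding-theory lemma feeding a theorem
about cubic Boolean functions on 8 bits — NOT summit progress.

The `13/16` isolation proof on 8 bits meets Boolean functions living on a COSET `c ⊕ S` of an `⊕`-closed set `S ⊂ 𝔽₂ⁿ` with `|S| = 2^m`
(a flat that is not a coordinate cube), about which one knows only that their number of ones on every PARAMETRISED `(r+1)`-flat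
`b ⊕ ⟨a₀,…,a_r⟩` (`b` in the coset, directions `aᵢ ∈ S`, counted over the `2^{r+1}` parameters with multiplicity) is EVEN — the flat-language
form of "degree `≤ r` along the coset".  `erm_weight_ge` is the Reed–Muller minimum distance in this language: such a function that does not vanish
on the coset has at least `2^{m−r}` ones there (`2^m ≤ 2^r · #ones`).  Proof: the textbook `(u, u ⊕ v)` induction (MacWilliams–Sloane Ch. 13 §3,
Thm 3), run on the coset: split `S = S₁ ⊔ (t ⊕ S₁)` along a coordinate where some `t ∈ S` is `1`; the derivative `h ⊕ h(· ⊕ t)` has even counts on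
`r`-flats of `c ⊕ S₁` (an `r`-flat and its `t`-translate form an `(r+1)`-flat, `erm_flatPt_cons`), and `wt h ≥ wt(h ⊕ h(·⊕t))`, `= 2·wt(h|_{c⊕S₁})`
when the derivative vanishes.  The case `r = 0` (pair counts even ⇒ constant on the coset) starts the induction.

References: F. J. MacWilliams, N. J. A. Sloane, *The Theory of Error-Correcting Codes* (1977), Ch. 13 §3; C. Carlet, *Boolean Functions for
Cryptography and Coding Theory*, CUP 2021, Thm 7.  Everything below is proved from Mathlib and the tree; axioms are the standard three.
-/

set_option linter.dupNamespace false -- D-0017: single-problem summit ⇒ `QuantumAdvantage.QuantumAdvantage` by design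

noncomputable section

namespace Summit.QuantumAdvantage.QuantumAdvantage.Theorems.CubicForrelation.NearExactIsExact

open Finset
open Literature.Computability.QuantumComplexity
open Literature.Computability.QuantumComplexity.BuzetChailloux (bxor zeroVec bxor_bxor_cancel_left bxor_zeroVec zeroVec_bxor bxor_self
  bxor_comm bxor_eq_zeroVec_iff)

variable {n : ℕ}

/-! ### Parametrised flats: adding one direction -/

/-- Adding a direction `t` (parameter `e`) in front of a parametrised flat translates the point by `e·t`:
`b ⊕ ⊕_{(e,ε)} = (b ⊕ ⊕_ε aᵢ) ⊕ e·t`. [folklore] -/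
theorem erm_flatPt_cons {k : ℕ} (b t : Fin n → Bool) (a : Fin k → Fin n → Bool) (e : Bool) (ε : Fin k → Bool) :
    (fun j => b j ^^ decide (Odd #(univ.filter fun i : Fin (k + 1) =>
        (Fin.cons e ε : Fin (k + 1) → Bool) i && (Fin.cons t a : Fin (k + 1) → Fin n → Bool) i j))) =
      fun j => (b j ^^ decide (Odd #(univ.filter fun i : Fin k => ε i && a i j))) ^^ (e && t j) := by
  funext j
  rw [card_filter, Fin.sum_univ_succ, card_filter]
  simp only [Fin.cons_zero, Fin.cons_succ]
  cases (e && t j)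
  · simp
  · simp only [if_true, Bool.xor_true]
    rw [add_comm, ed_decide_odd_succ]
    cases b j <;> cases decide (Odd (∑ i : Fin k, if (ε i && a i j) = true then 1 else 0)) <;> rfl

/-- Splitting a count over `𝔽₂^{k+1}` by the first parameter. [folklore] -/
theorem erm_card_split {k : ℕ} (P : (Fin (k + 1) → Bool) → Prop) [DecidablePred P] :
    #(univ.filter P) = #(univ.filter fun ε : Fin k → Bool => P (Fin.cons false ε)) +
      #(univ.filter fun ε : Fin k → Bool => P (Fin.cons true ε)) := by
  have hu : (univ : Finset (Fin (k + 1) → Bool)) =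
      univ.image (fun ε : Fin k → Bool => (Fin.cons false ε : Fin (k + 1) → Bool)) ∪
        univ.image (fun ε : Fin k → Bool => (Fin.cons true ε : Fin (k + 1) → Bool)) := by
    ext ε
    simp only [mem_univ, mem_union, mem_image, true_and, true_iff]
    cases h : ε 0
    · exact Or.inl ⟨Fin.tail ε, by rw [← h, Fin.cons_self_tail]⟩
    · exact Or.inr ⟨Fin.tail ε, by rw [← h, Fin.cons_self_tail]⟩
  have hdis : Disjoint (univ.image (fun ε : Fin k → Bool => (Fin.cons false ε : Fin (k + 1) → Bool)))
      (univ.image (fun ε : Fin k → Bool => (Fin.cons true ε : Fin (k + 1) → Bool))) := by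
    rw [disjoint_left]
    rintro ε h1 h2
    obtain ⟨a, -, rfl⟩ := mem_image.1 h1
    obtain ⟨b, -, hb⟩ := mem_image.1 h2
    have := congrFun hb 0
    simp only [Fin.cons_zero] at this
    exact Bool.noConfusion this
  rw [hu, filter_union, card_union_of_disjoint (disjoint_filter_filter hdis), filter_image, filter_image,
    card_image_of_injective _ (Fin.cons_right_injective (α := fun _ => Bool) false),
    card_image_of_injective _ (Fin.cons_right_injective (α := fun _ => Bool) true)]

/-- Parity of a xor count: `#{P ⊕ Q} ≡ #{P} + #{Q} (mod 2)`. [folklore] -/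
theorem erm_even_card_xor {α : Type*} [Fintype α] (P Q : α → Bool) (h : Even (#(univ.filter fun x => P x = true) +
    #(univ.filter fun x => Q x = true))) : Even #(univ.filter fun x => (P x ^^ Q x) = true) := by
  have key : #(univ.filter fun x => (P x ^^ Q x) = true) + 2 * #(univ.filter fun x => (P x && Q x) = true) =
      #(univ.filter fun x => P x = true) + #(univ.filter fun x => Q x = true) := by
    rw [card_filter, card_filter, card_filter, card_filter, mul_sum, ← sum_add_distrib, ← sum_add_distrib]
    refine sum_congr rfl fun x _ => ?_
    cases P x <;> cases Q x <;> simp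
  obtain ⟨w, hw⟩ := h
  exact ⟨w - #(univ.filter fun x => (P x && Q x) = true), by omega⟩

/-! ### Halving an `⊕`-closed set along a coordinate -/

/-- If `t ∈ S` has `t_i = 1`, the `⊕`-closed set `S` is the disjoint union of `S₁ = {v ∈ S : v_i = 0}` and `t ⊕ S₁`; hence `|S| = 2|S₁|`.
[folklore] -/
theorem erm_halving (S : Finset (Fin n → Bool)) (hadd : ∀ x ∈ S, ∀ y ∈ S, bxor x y ∈ S) (t : Fin n → Bool) (ht : t ∈ S)
    (i : Fin n) (hti : t i = true) :
    S = S.filter (fun v => v i = false) ∪ (S.filter fun v => v i = false).image (bxor t) ∧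
    Disjoint (S.filter fun v => v i = false) ((S.filter fun v => v i = false).image (bxor t)) ∧
    #S = 2 * #(S.filter fun v => v i = false) := by
  have hsub : S = S.filter (fun v => v i = false) ∪ (S.filter fun v => v i = false).image (bxor t) := by
    ext v
    simp only [mem_union, mem_filter, mem_image]
    constructor
    · intro hv
      cases hvi : v i
      · exact Or.inl ⟨hv, rfl⟩
      · refine Or.inr ⟨bxor t v, ⟨hadd t ht v hv, ?_⟩, bxor_bxor_cancel_left t v⟩
        show (t i ^^ v i) = false
        rw [hti, hvi]; rfl
    · rintro (⟨hv, -⟩ | ⟨w, ⟨hw, -⟩, rfl⟩)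
      · exact hv
      · exact hadd t ht w hw
  have hdis : Disjoint (S.filter fun v => v i = false) ((S.filter fun v => v i = false).image (bxor t)) := by
    rw [disjoint_left]
    rintro v hv hv'
    obtain ⟨w, hw, rfl⟩ := mem_image.1 hv'
    have h1 := (mem_filter.1 hv).2
    have h2 := (mem_filter.1 hw).2
    have : (t i ^^ w i) = false := h1
    rw [hti, h2] at this
    exact Bool.noConfusion this
  refine ⟨hsub, hdis, ?_⟩
  conv_lhs => rw [hsub]
  rw [card_union_of_disjoint hdis, card_image_of_injective _ fun x y hxy => by
    simpa only [bxor_bxor_cancel_left] using congrArg (bxor t) hxy]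
  ring

/-! ### The Reed–Muller distance on a coset -/

/-- **Reed–Muller minimum distance on an abstract flat.** Let `S ∋ 0` be `⊕`-closed with `|S| = 2^m`, `c` a base point, and `h` a Boolean
function whose number of ones on every parametrised `(r+1)`-flat `b ⊕ ⟨a₀,…,a_r⟩` with `b ∈ c ⊕ S`, `aᵢ ∈ S` is even.  If `h` has a one on
`c ⊕ S` then it has at least `2^{m−r}` ones there: `2^m ≤ 2^r · #{x ∈ c ⊕ S : h(x) = 1}`. [cite: MacWilliamsSloane1977, Ch. 13 §3 Thm 3] -/
theorem erm_weight_ge : ∀ (m r : ℕ) (S : Finset (Fin n → Bool)), zeroVec ∈ S → (∀ x ∈ S, ∀ y ∈ S, bxor x y ∈ S) → #S = 2 ^ m →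
    ∀ (c : Fin n → Bool) (h : (Fin n → Bool) → Bool),
    (∀ b ∈ S.image (bxor c), ∀ a : Fin (r + 1) → Fin n → Bool, (∀ i, a i ∈ S) →
      Even #(univ.filter fun ε : Fin (r + 1) → Bool =>
        h (fun j => b j ^^ decide (Odd #(univ.filter fun i => ε i && a i j))) = true)) →
    (∃ x ∈ S.image (bxor c), h x = true) →
    2 ^ m ≤ 2 ^ r * #((S.image (bxor c)).filter fun x => h x = true) := by
  classical
  intro m
  induction m with
  | zero =>
    intro r S h0 hadd hcard c h _ hex
    obtain ⟨x, hx, hxt⟩ := hex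
    have h1 : 1 ≤ #((S.image (bxor c)).filter fun x => h x = true) := card_pos.2 ⟨x, mem_filter.2 ⟨hx, hxt⟩⟩
    calc 2 ^ 0 = 1 := rfl
      _ ≤ 2 ^ r * 1 := by simpa using Nat.one_le_two_pow
      _ ≤ 2 ^ r * #((S.image (bxor c)).filter fun x => h x = true) := Nat.mul_le_mul_left _ h1
  | succ m ih =>
    intro r S h0 hadd hcard c h hflat hex
    -- pair counts: `h b = h (b ⊕ s)` whenever the 1-flat counts are even
    have hpair : ∀ (k : ℕ) (hh : (Fin n → Bool) → Bool), (∀ b ∈ S.image (bxor c), ∀ a : Fin (k + 1) → Fin n → Bool, (∀ i, a i ∈ S) →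
        Even #(univ.filter fun ε : Fin (k + 1) → Bool =>
          hh (fun j => b j ^^ decide (Odd #(univ.filter fun i => ε i && a i j))) = true)) →
        k = 0 → ∀ b ∈ S.image (bxor c), ∀ s ∈ S, hh (bxor b s) = hh b := by
      intro k hh hfl hk b hb s hs
      subst hk
      have he := hfl b hb (fun _ => s) fun _ => hs
      rw [erm_card_split] at he
      have hpt : ∀ e : Bool, (fun j => b j ^^ decide (Odd #(univ.filter fun i : Fin (0 + 1) =>
          (Fin.cons e (fun i : Fin 0 => i.elim0) : Fin (0 + 1) → Bool) i && s j))) = fun j => b j ^^ (e && s j) := by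
        intro e
        have := erm_flatPt_cons b s (fun i : Fin 0 => i.elim0) e (fun i : Fin 0 => i.elim0)
        rw [show (Fin.cons s (fun i : Fin 0 => i.elim0) : Fin (0 + 1) → Fin n → Bool) = fun _ => s from by
          funext i; exact Fin.cases rfl (fun i => i.elim0) i] at this
        rw [this]
        funext j; simp
      have huniv : ∀ (Q : (Fin 0 → Bool) → Prop) [DecidablePred Q], #(univ.filter Q) = if Q (fun i => i.elim0) then 1 else 0 := by
        intro Q _
        rw [show (univ : Finset (Fin 0 → Bool)) = {fun i => i.elim0} from by
          ext ε; simp only [mem_univ, mem_singleton, true_iff]; funext i; exact i.elim0]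
        rw [filter_singleton]; split_ifs <;> simp
      rw [huniv, huniv, hpt, hpt] at he
      simp only [Bool.false_and, Bool.xor_false, Bool.true_and] at he
      by_contra hne
      have h1 : ((if h' : hh (fun j => b j) = true then 1 else 0) + if hh (fun j => b j ^^ s j) = true then 1 else 0) = 1 := by
        have : (fun j => b j) = b := rfl
        rw [this]
        have hbs : (fun j => b j ^^ s j) = bxor b s := rfl
        rw [hbs]
        revert hne; cases hh b <;> cases hh (bxor b s) <;> simp
      simp only [dite_eq_ite] at h1
      rw [h1] at he
      exact Nat.not_even_one he
    cases r with
    | zero =>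
      -- all of the coset is `1`
      obtain ⟨x, hx, hxt⟩ := hex
      have hall : ∀ y ∈ S.image (bxor c), h y = true := by
        intro y hy
        obtain ⟨s₁, hs₁, rfl⟩ := mem_image.1 hy
        obtain ⟨s₂, hs₂, rfl⟩ := mem_image.1 hx
        have : bxor c s₁ = bxor (bxor c s₂) (bxor s₂ s₁) := by
          funext j; show (c j ^^ s₁ j) = ((c j ^^ s₂ j) ^^ (s₂ j ^^ s₁ j)); cases s₂ j <;> simp
        rw [this, hpair 0 h hflat rfl _ hx _ (hadd _ hs₂ _ hs₁)]
        exact hxt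
      rw [filter_true_of_mem hall, card_image_of_injective _ fun x y hxy => by
        simpa only [bxor_bxor_cancel_left] using congrArg (bxor c) hxy, hcard]
      simp
    | succ r' =>
      -- a direction `t ≠ 0` in `S` and a coordinate where it is `1`
      obtain ⟨v₁, hv₁, v₂, hv₂, hne⟩ : ∃ v₁ ∈ S, ∃ v₂ ∈ S, v₁ ≠ v₂ :=
        one_lt_card.1 (by rw [hcard]; exact Nat.one_lt_two_pow (by omega))
      set t := bxor v₁ v₂ with htdef
      have ht : t ∈ S := hadd _ hv₁ _ hv₂
      have ht0 : t ≠ zeroVec := fun h' => hne ((bxor_eq_zeroVec_iff v₁ v₂).1 h')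
      obtain ⟨i, hti⟩ : ∃ i, t i = true := by
        by_contra hno; push Not at hno
        exact ht0 (funext fun j => by simpa [zeroVec] using hno j)
      set S₁ := S.filter (fun v => v i = false) with hS₁def
      obtain ⟨hS, hdis, hcard2⟩ := erm_halving S hadd t ht i hti
      have h0' : zeroVec ∈ S₁ := mem_filter.2 ⟨h0, rfl⟩
      have hadd' : ∀ x ∈ S₁, ∀ y ∈ S₁, bxor x y ∈ S₁ := by
        intro x hx y hy
        refine mem_filter.2 ⟨hadd _ (mem_filter.1 hx).1 _ (mem_filter.1 hy).1, ?_⟩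
        show (x i ^^ y i) = false
        rw [(mem_filter.1 hx).2, (mem_filter.1 hy).2]; rfl
      have hcard' : #S₁ = 2 ^ m := by
        have : 2 * #S₁ = 2 * 2 ^ m := by rw [← hcard2, hcard, pow_succ, mul_comm]
        omega
      have hsub₁ : S₁ ⊆ S := filter_subset _ _
      -- the two half-cosets
      obtain ⟨C₀, hC₀def⟩ : ∃ C₀ : Finset (Fin n → Bool), C₀ = S₁.image (bxor c) := ⟨_, rfl⟩
      have hC₀sub : C₀ ⊆ S.image (bxor c) := hC₀def ▸ image_subset_image hsub₁
      have hinv : ∀ x : Fin n → Bool, bxor (bxor x t) t = x := fun x => by funext j; simp [bxor]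
      have hCsplit : S.image (bxor c) = C₀ ∪ C₀.image (fun x => bxor x t) := by
        conv_lhs => rw [hS]
        rw [image_union, hC₀def, image_image, image_image]
        congr 1
        refine image_congr fun v _ => ?_
        funext j; simp only [Function.comp_apply, bxor, htdef]
        cases v₁ j <;> cases v₂ j <;> cases v j <;> cases c j <;> rfl
      have hCdis : Disjoint C₀ (C₀.image fun x => bxor x t) := by
        rw [disjoint_left]
        rintro x hx hx'
        rw [hC₀def] at hx hx'
        obtain ⟨v, hv, rfl⟩ := mem_image.1 hx
        obtain ⟨y, hy, hxy⟩ := mem_image.1 hx'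
        obtain ⟨w, hw, rfl⟩ := mem_image.1 hy
        have h1 := (mem_filter.1 hv).2
        have h2 := (mem_filter.1 hw).2
        have := congrFun hxy i
        simp only [bxor, h1, h2, hti] at this
        revert this; cases c i <;> decide
      -- weight bookkeeping
      set h₁ : (Fin n → Bool) → Bool := fun x => h x ^^ h (bxor x t) with hh₁def
      have himg : #((C₀.image fun x => bxor x t).filter fun x => h x = true) = #(C₀.filter fun x => h (bxor x t) = true) := by
        rw [filter_image, card_image_of_injective _ fun x y (hxy : bxor x t = bxor y t) => by
          rw [← hinv x, hxy, hinv]]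
      have hW : #((S.image (bxor c)).filter fun x => h x = true) =
          #(C₀.filter fun x => h x = true) + #(C₀.filter fun x => h (bxor x t) = true) := by
        rw [hCsplit, filter_union, card_union_of_disjoint (disjoint_filter_filter hCdis), himg]
      have hW₁ : #(C₀.filter fun x => h₁ x = true) ≤
          #(C₀.filter fun x => h x = true) + #(C₀.filter fun x => h (bxor x t) = true) := by
        refine (card_le_card fun x hx => ?_).trans (card_union_le _ _)
        have hxC := (mem_filter.1 hx).1
        have hx' : (h x ^^ h (bxor x t)) = true := (mem_filter.1 hx).2
        rw [mem_union, mem_filter, mem_filter]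
        cases hh : h x
        · cases hh' : h (bxor x t)
          · rw [hh, hh'] at hx'; exact absurd hx' (by decide)
          · exact Or.inr ⟨hxC, rfl⟩
        · exact Or.inl ⟨hxC, rfl⟩
      -- the flat hypotheses on the half-coset
      have hflat₀ : ∀ b ∈ C₀, ∀ a : Fin (r' + 1 + 1) → Fin n → Bool, (∀ i, a i ∈ S₁) →
          Even #(univ.filter fun ε : Fin (r' + 1 + 1) → Bool =>
            h (fun j => b j ^^ decide (Odd #(univ.filter fun i => ε i && a i j))) = true) :=
        fun b hb a ha => hflat b (hC₀sub hb) a fun i => hsub₁ (ha i)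
      have hflat₁ : ∀ b ∈ C₀, ∀ a : Fin (r' + 1) → Fin n → Bool, (∀ i, a i ∈ S₁) →
          Even #(univ.filter fun ε : Fin (r' + 1) → Bool =>
            h₁ (fun j => b j ^^ decide (Odd #(univ.filter fun i => ε i && a i j))) = true) := by
        intro b hb a ha
        have he := hflat b (hC₀sub hb) (Fin.cons t a) fun i => Fin.cases ht (fun i => hsub₁ (ha i)) i
        rw [erm_card_split] at he
        simp only [erm_flatPt_cons, Bool.false_and, Bool.xor_false, Bool.true_and] at he
        refine erm_even_card_xor _ _ ?_
        exact he
      -- case analysis on the derivative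
      by_cases hex₁ : ∃ x ∈ C₀, h₁ x = true
      · have hIH := ih r' S₁ h0' hadd' hcard' c h₁ (by rw [← hC₀def]; exact hflat₁) (by rw [← hC₀def]; exact hex₁)
        rw [← hC₀def] at hIH
        rw [hW, pow_succ, pow_succ]
        calc 2 ^ m * 2 ≤ 2 ^ r' * #(C₀.filter fun x => h₁ x = true) * 2 := Nat.mul_le_mul_right _ hIH
          _ ≤ 2 ^ r' * (#(C₀.filter fun x => h x = true) + #(C₀.filter fun x => h (bxor x t) = true)) * 2 :=
              Nat.mul_le_mul_right _ (Nat.mul_le_mul_left _ hW₁)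
          _ = 2 ^ r' * 2 * (#(C₀.filter fun x => h x = true) + #(C₀.filter fun x => h (bxor x t) = true)) := by ring
      · push Not at hex₁
        have hper : ∀ x ∈ C₀, h (bxor x t) = h x := by
          intro x hx
          have := hex₁ x hx
          rw [hh₁def] at this; simp only [Bool.not_eq_true] at this
          revert this; cases h x <;> cases h (bxor x t) <;> simp
        have hW' : #(C₀.filter fun x => h (bxor x t) = true) = #(C₀.filter fun x => h x = true) :=
          congrArg card (filter_congr fun x hx => by rw [hper x hx])
        have hex₀ : ∃ x ∈ C₀, h x = true := by
          obtain ⟨x, hx, hxt⟩ := hex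
          rw [hCsplit, mem_union] at hx
          rcases hx with hx | hx
          · exact ⟨x, hx, hxt⟩
          · obtain ⟨y, hy, rfl⟩ := mem_image.1 hx
            exact ⟨y, hy, by rw [← hper y hy]; exact hxt⟩
        have hIH := ih (r' + 1) S₁ h0' hadd' hcard' c h (by rw [← hC₀def]; exact hflat₀) (by rw [← hC₀def]; exact hex₀)
        rw [← hC₀def] at hIH
        rw [hW, hW', pow_succ]
        calc 2 ^ m * 2 ≤ 2 ^ (r' + 1) * #(C₀.filter fun x => h x = true) * 2 := Nat.mul_le_mul_right _ hIH
          _ = 2 ^ (r' + 1) * (#(C₀.filter fun x => h x = true) + #(C₀.filter fun x => h x = true)) := by ring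

end Summit.QuantumAdvantage.QuantumAdvantage.Theorems.CubicForrelation.NearExactIsExact

end
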